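import Summits.ABC.IUTFork.Cor312PilotKummerCompat
import Summits.ABC.IUTFork.Cor312PinnedLogShellOneRho
import HarnessLib

/-!
# IUT REPAIR branch (rung LADDER-ABC:A2.RP), sub-cell B0 class (i) INTERNAL, file `CandInternal16` (abc-iut-rp-d1): what the typed
# Corollary BECOMES under the class-(i) hypothesis — ORBIT COLLAPSE: if the Θ-pilot's Kummer data are insulated from ⟨(Ind1) ∪ (Ind2)⟩,
# the possible images form ONE region per packet, `ⁿ˒°𝒰_{j,v_ℚ}` is the hull of that single region, and the hull-level residual `GapH3`
# reads «ρ(qK) ⊆ hull(ρ(Ψ_n))» — no (Ind1)/(Ind2) inflation; whatever inflation there is comes from the hull frame / (Ind3)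

Record file (D-0012) of the abc-iut cell's IUT REPAIR branch (human ruling D-0077(2); director-abc MINT 2026-08-26T05:11:35Z + ERRATUM
05:12:15Z; REPAIR-SPEC v0, seat abc-iut-rp-d1, k = 16 ≡ 1 (mod 3); a STRUCTURAL companion to rows RP-I03/I07/I13/I14 for the §J census and
for rp-bar's BAR-S / rp-d2's level-H/S rows). PROOF-ONLY: 0 definitions, 0 `Prop` facts; every hypothesis inline. TAKES NO SIDE on [IUTchIII]
Cor. 3.12. DEFS-FREEZE respected (imports the adjudication-closure files only); written over the frozen vocabulary (no dependence on the
not-yet-built `Repair.CandInternal1`: the insulation hypothesis is spelled inline — it is `CandInternal1.Hins S P ⟨Ind1 ∪ Ind2⟩` under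
Thm. 3.11 (ii)(b), cf. `CandInternal1.linkTransport_iff_eq_frobΨ_of_Hins` / `CandInternal4.H_iff_sub_frobΨ_of_insulated`).

## SOURCE («p.N l.M» = line M of page N of the cell's kurims renders)
[IUTchIII] `paper:url-4b091feeb646` Thm. 2.2 (ii) p.66 l.39–56 («the identity automorphism on [the theta monoids, the cyclotome, the
mono-theta environments, the splittings] is compatible … with … arbitrary automorphisms ∈ Aut_{F⊢×μ}(†𝔉⊢×μ_△)»); Rmk. 2.2.2 (ii) p.70
l.33–36 («the indeterminacies in the multiradial formulation given for theta monoids … essentially consist of multiplication by roots of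
unity … are essentially negligible»); Cor. 3.12 p.173 l.46 – p.174 l.3 (the holomorphic hull of the UNION of the possible images); [EtTh]
Cor. 2.19 (i)/(iii) `paper:url-b1bf576d3169` p.58 l.12 – p.60 l.6. [claim: Mochizuki2012, status: disputed] [cite: MochizukiEtTh2009, Cor 2.19(i) p.64]
HONEST CAVEAT (T-d input): print's «negligible indeterminacies» sentence is about THETA monoids, and Rmk. 2.2.2 (ii) adds that the
indeterminacies for GAUSSIAN monoids (the data of Thm. 3.11) are «substantially more severe»; insulation under the WHOLE ⟨(Ind1) ∪ (Ind2)⟩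
(the hypothesis `hins` below) is what holds in every one-place sign model of the tree (`naiveFull`: `NaiveWitness.image_Psi_of_actsBySigns`),
and is STRONGER than what [EtTh] prints for (Ind1). The theorems below are CONDITIONAL on it and say what it entails; nothing is asserted.

## RESULTS (kernel, general `LatticeSituation`; all hypotheses inline)
* `possibleImages_eq_singleton_of_insulated`: Θ-pin (pΘ)+(hρ) ∧ Thm. 3.11 (ii)(b) `KummerB` ∧ insulation `hins` ⟹ at every packet
  `possibleImages j vQ = {thetaRegion3 j vQ}` — the (Ind1)/(Ind2)-ORBIT of the Θ-pilot region COLLAPSES (every indeterminacy translate of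
  `ρ(Ψ_n)` is `ρ(Φ·Ψ_n) = ρ(Ψ_n)`).
* `thetaHull_eq_hull_thetaRegion3_of_insulated`: hence `ⁿ˒°𝒰_{j,v_ℚ} = hull(ρ(Ψ_n))` — the Θ-quantity `−|log(Θ)|` is the procession-normalised
  hull-volume of ONE region per packet.
* `gapH3_iff_of_insulated` / `licence_iff_of_insulated`: under the pins, the hull-level residual of record reads «`ρ(qK) ⊆ hull(ρ(Ψ_n))` at
  every label of 𝔽_l^⋇»; `reading3_iff_eq_of_insulated`: the identification-level Reading R3 reads «`ρ(qK) = ρ(Ψ_n)`» (cf. BAR-V).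
* `naive_orbit_collapse`: the hypothesis holds over abc-iut-w5-d247's naive situation for EVERY setting (all of the tree's countermodels and
  positive models), where indeed `possibleImages = {B_{j²}}` (abc-iut-w4-d101 `pinnedSetting_possibleImages`) — so in that family NO inflation
  ever comes from (Ind1)/(Ind2); abc-iut-w4-d103's `flipSetting` inflates through the FRAME, `shellSetting`/`rhoOne` through (Ind3)/`ρ`.
READING (neutral): the class-(i) hypothesis removes the (Ind1)/(Ind2) contribution to `−|log(Θ)|`; a repair compatible with it must find its
inflation in the holomorphic hull of a single region or in (Ind3) (rows RP-I05/I06, RP-M05/M06; BAR-S's inflation-dominance datum). No side taken.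
-/

noncomputable section

open Set

namespace Summit.ABC.IUTFork.Repair

open Thm311 Cor312 Cor312Vol Literature.IUT.LogThetaLattice

namespace CandInternal16

section General

variable {T : ThetaIndex} (S : LatticeSituation T) (P : Cor312.Setting S.toSituation)
  (ρ : (∀ v : T.V, v ∈ T.Vbad → Set (S.L.StarPacket v)) → ∀ (j : T.Label) (vQ : T.VQ), Set (S.L.Packet j vQ))
  (qK : ∀ v : T.V, v ∈ T.Vbad → Set (S.L.StarPacket v))

/-- **ORBIT COLLAPSE under insulation.** If the region operator satisfies the Θ-pin (pΘ) with its equivariance (hρ) (abc-iut-w5-d230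
`ThetaPinned`), Thm. 3.11 (ii)(b) holds for the column, and the CORIC Θ-splitting monoid is set-wise fixed by every element of ⟨(Ind1) ∪
(Ind2)⟩ (INLINE hypothesis `hins` — the class-(i) insulation of [IUTchIII] Thm. 2.2 (ii) p.66 l.39–56 extended to the whole indeterminacy
group; = `CandInternal1.Hins S P ⟨Ind1 ∪ Ind2⟩` under (ii)(b)), then the possible images of the Θ-pilot at every packet form the SINGLETON
`{thetaRegion3}`. [claim: Mochizuki2012, status: disputed] -/
theorem possibleImages_eq_singleton_of_insulated (hKumB : (S.col P.n).KummerB (S.D P.n)) (hΘ : ThetaPinned S P ρ)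
    (hins : ∀ Φ ∈ Subgroup.closure (S.L.Ind1Family ∪ S.L.Ind2Family), ∀ (v : T.V) (hv : v ∈ T.Vbad),
      S.L.starAut Φ v '' (S.D P.n).Ψ v hv = (S.D P.n).Ψ v hv)
    (j : T.Label) (vQ : T.VQ) : P.possibleImages j vQ = {P.thetaRegion3 j vQ} := by
  have h3 : P.thetaRegion3 j vQ = ρ (S.D P.n).Ψ j vQ := thetaRegion3_eq_of_thetaPinned S P ρ hKumB hΘ j vQ
  ext U
  simp only [Set.mem_singleton_iff]
  constructor
  · rintro ⟨Φ, hΦ, rfl⟩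
    have hΦ' : Φ ∈ Subgroup.closure (S.L.Ind1Family ∪ S.L.Ind2Family) := by
      rw [← GluedMonoids.indGroup_eq]; exact hΦ
    have hΨ : (fun v hv => S.L.starAut Φ v '' (S.D P.n).Ψ v hv) = (S.D P.n).Ψ :=
      funext fun v => funext fun hv => hins Φ hΦ' v hv
    rw [h3, ← hΘ.1 Φ hΦ', hΨ]
  · rintro rfl
    exact P.thetaRegion3_mem_possibleImages j vQ

/-- … hence the union of the possible images is that one region … [folklore] -/
theorem sUnion_possibleImages_of_insulated (hKumB : (S.col P.n).KummerB (S.D P.n)) (hΘ : ThetaPinned S P ρ)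
    (hins : ∀ Φ ∈ Subgroup.closure (S.L.Ind1Family ∪ S.L.Ind2Family), ∀ (v : T.V) (hv : v ∈ T.Vbad),
      S.L.starAut Φ v '' (S.D P.n).Ψ v hv = (S.D P.n).Ψ v hv)
    (j : T.Label) (vQ : T.VQ) : ⋃₀ P.possibleImages j vQ = ρ (S.D P.n).Ψ j vQ := by
  rw [possibleImages_eq_singleton_of_insulated S P ρ hKumB hΘ hins, Set.sUnion_singleton,
    thetaRegion3_eq_of_thetaPinned S P ρ hKumB hΘ]

/-- **… and `ⁿ˒°𝒰_{j,v_ℚ}` is the holomorphic hull of the SINGLE region `ρ(Ψ_n)`**: under insulation the Θ-quantity `−|log(Θ)|` of Cor. 3.12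
is the procession-normalised hull-volume of one region per packet — no (Ind1)/(Ind2) contribution. [claim: Mochizuki2012, status: disputed] -/
theorem thetaHull_eq_hull_of_insulated (hKumB : (S.col P.n).KummerB (S.D P.n)) (hΘ : ThetaPinned S P ρ)
    (hins : ∀ Φ ∈ Subgroup.closure (S.L.Ind1Family ∪ S.L.Ind2Family), ∀ (v : T.V) (hv : v ∈ T.Vbad),
      S.L.starAut Φ v '' (S.D P.n).Ψ v hv = (S.D P.n).Ψ v hv)
    (j : T.Label) (vQ : T.VQ) : P.thetaHull j vQ = (P.frame j vQ).hull (ρ (S.D P.n).Ψ j vQ) := by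
  unfold Setting.thetaHull
  rw [sUnion_possibleImages_of_insulated S P ρ hKumB hΘ hins]

/-- **The (xi-f) `Licence` under insulation and the q-pin**: «`ρ(qK) ⊆ hull(ρ(Ψ_n))` at every label of 𝔽_l^⋇». [claim: Mochizuki2012, status: disputed] -/
theorem licence_iff_of_insulated (hKumB : (S.col P.n).KummerB (S.D P.n)) (hpin : PinnedRegions S P ρ qK)
    (hins : ∀ Φ ∈ Subgroup.closure (S.L.Ind1Family ∪ S.L.Ind2Family), ∀ (v : T.V) (hv : v ∈ T.Vbad),
      S.L.starAut Φ v '' (S.D P.n).Ψ v hv = (S.D P.n).Ψ v hv) :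
    Thm311ToCor312.Licence P ↔ ∀ (i : Fin T.lstar) (vQ : T.VQ),
      ρ qK (Setting.labelSucc i) vQ ⊆ (P.frame (Setting.labelSucc i) vQ).hull (ρ (S.D P.n).Ψ (Setting.labelSucc i) vQ) := by
  refine forall₂_congr fun i vQ => ?_
  rw [hpin.2 (Setting.labelSucc i) vQ, thetaHull_eq_hull_of_insulated S P ρ hKumB hpin.1 hins]

/-- **`gapH3_iff_of_insulated` — the hull-level residual of record under the class-(i) hypothesis**: THREE PINS ⟹ «`ρ(qK) ⊆ hull(ρ(Ψ_n))` at
every label of 𝔽_l^⋇». Whatever makes this true is inflation of ONE region by the hull frame (or an (Ind3)-aware `ρ`), never an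
(Ind1)/(Ind2)-orbit. [claim: Mochizuki2012, status: disputed] -/
theorem gapH3_iff_of_insulated (hKumB : (S.col P.n).KummerB (S.D P.n)) (hpin : PinnedRegions3 S P ρ qK)
    (hins : ∀ Φ ∈ Subgroup.closure (S.L.Ind1Family ∪ S.L.Ind2Family), ∀ (v : T.V) (hv : v ∈ T.Vbad),
      S.L.starAut Φ v '' (S.D P.n).Ψ v hv = (S.D P.n).Ψ v hv) :
    GapH3 S P ρ qK ↔ ∀ (i : Fin T.lstar) (vQ : T.VQ),
      ρ qK (Setting.labelSucc i) vQ ⊆ (P.frame (Setting.labelSucc i) vQ).hull (ρ (S.D P.n).Ψ (Setting.labelSucc i) vQ) := by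
  rw [← licence_iff_of_insulated S P ρ qK hKumB hpin.1 hins]
  exact ⟨fun h => h hpin, fun h _ => h⟩

/-- **Reading R3 under insulation and the pins is the bare identity of regions** «`ρ(qK) = ρ(Ψ_n)`» in every packet (the only possible
image is `ρ(Ψ_n)`) — rp-bar's `VolumePinned` with equality of regions in place of equality of volumes. [claim: Mochizuki2012, status: disputed] -/
theorem reading3_iff_eq_of_insulated (hKumB : (S.col P.n).KummerB (S.D P.n)) (hpin : PinnedRegions S P ρ qK)
    (hins : ∀ Φ ∈ Subgroup.closure (S.L.Ind1Family ∪ S.L.Ind2Family), ∀ (v : T.V) (hv : v ∈ T.Vbad),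
      S.L.starAut Φ v '' (S.D P.n).Ψ v hv = (S.D P.n).Ψ v hv) :
    (∀ (j : T.Label) (vQ : T.VQ), P.qRegion j vQ ∈ P.possibleImages j vQ) ↔
      ∀ (j : T.Label) (vQ : T.VQ), ρ qK j vQ = ρ (S.D P.n).Ψ j vQ := by
  refine forall₂_congr fun j vQ => ?_
  rw [possibleImages_eq_singleton_of_insulated S P ρ hKumB hpin.1 hins, Set.mem_singleton_iff, hpin.2 j vQ,
    thetaRegion3_eq_of_thetaPinned S P ρ hKumB hpin.1]

/-- … so the residual of record S, under insulation and the pins, is that identity too (abc-iut-w5-d230 `reading3_iff_pilotKummerIndRelated`).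
[claim: Mochizuki2012, status: disputed] -/
theorem pilotKummerIndRelated_iff_eq_of_insulated (hKumB : (S.col P.n).KummerB (S.D P.n)) (hpin : PinnedRegions S P ρ qK)
    (hins : ∀ Φ ∈ Subgroup.closure (S.L.Ind1Family ∪ S.L.Ind2Family), ∀ (v : T.V) (hv : v ∈ T.Vbad),
      S.L.starAut Φ v '' (S.D P.n).Ψ v hv = (S.D P.n).Ψ v hv) :
    Summit.ABC.IUTFork.Cor312Vol.PilotKummerIndRelated S P ρ qK ↔
      ∀ (j : T.Label) (vQ : T.VQ), ρ qK j vQ = ρ (S.D P.n).Ψ j vQ := by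
  rw [← reading3_iff_pilotKummerIndRelated S P ρ qK hKumB hpin, reading3_iff_eq_of_insulated S P ρ qK hKumB hpin hins]

end General

/-! ## The naive family: the hypothesis holds for every setting — no (Ind1)/(Ind2) inflation anywhere in the tree's models -/

section Naive

open Cor312.Checks Cor312.IdentifiedNonVacuity NaiveWitness PinnedWitness PinnedHonest

variable (p : ℕ) [hp : Fact p.Prime]

omit hp in
/-- Over abc-iut-w5-d247's naive situation the coric Θ-splitting monoid `Ψ_v = {(±q^{j²})_j}` is fixed by every element of ⟨(Ind1) ∪ (Ind2)⟩
(everything acts by signs): the insulation hypothesis holds for EVERY column. [folklore] -/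
theorem naive_insulated (n : ℤ) :
    ∀ Φ ∈ Subgroup.closure (signShells.Ind1Family ∪ signShells.Ind2Family), ∀ (v : toyIndex.V) (hv : v ∈ toyIndex.Vbad),
      signShells.starAut Φ v '' ((naiveFull p).D n).Ψ v hv = ((naiveFull p).D n).Ψ v hv :=
  fun _ hΦ v _ => image_Psi_of_actsBySigns p (actsBySigns_of_mem_closure hΦ) v

omit hp in
/-- **`naive_orbit_collapse`**: for EVERY Θ-pinned setting over the naive situation — the countermodel `pinnedSetting`, the inflating
`flipSetting`, the log-shell family `shellSetting`, the positive models `withQDatum`/`linkIdSetting` — the possible images are a singleton at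
every packet: no inflation in the tree's models ever comes from (Ind1)/(Ind2). (For `pinnedSetting` this is abc-iut-w4-d101's
`pinnedSetting_possibleImages = {B_{j²}}`, re-derived structurally.) [folklore] -/
theorem naive_orbit_collapse (P : Cor312.Setting (naiveFull p).toLatticeSituation.toSituation)
    (ρ : (∀ v : toyIndex.V, v ∈ toyIndex.Vbad → Set (signShells.StarPacket v)) →
      ∀ (j : toyIndex.Label) (vQ : toyIndex.VQ), Set (signShells.Packet j vQ))
    (hΘ : ThetaPinned (naiveFull p).toLatticeSituation P ρ) (j : toyIndex.Label) (vQ : toyIndex.VQ) :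
    P.possibleImages j vQ = {P.thetaRegion3 j vQ} :=
  possibleImages_eq_singleton_of_insulated (naiveFull p).toLatticeSituation P ρ (naive_partII p P.n).2.1 hΘ
    (naive_insulated p P.n) j vQ

/-- Instance: at the pinned countermodel of record (operator `orbitRegion`). [folklore] -/
theorem pinned_orbit_collapse (j : toyIndex.Label) (vQ : toyIndex.VQ) :
    (pinnedSetting p).possibleImages j vQ = {(pinnedSetting p).thetaRegion3 j vQ} :=
  naive_orbit_collapse p (pinnedSetting p) (orbitRegion p) (pinnedSetting_thetaPinned p) j vQ

/-- Instance: on abc-iut-w4-d103's one-operator log-shell family (operator `rhoOne d`), every `d` — its inflation (`GapH3 ↔ 3 ≤ d`,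
`Statement ↔ 3 ≤ 2d`) is therefore entirely the (Ind3)/`ρ`-borne log-shell dilation of ONE region, as print's (Ind3) reading has it.
[folklore] -/
theorem shell_orbit_collapse (d : ℕ) (j : toyIndex.Label) (vQ : toyIndex.VQ) :
    (shellSetting p d).possibleImages j vQ = {(shellSetting p d).thetaRegion3 j vQ} :=
  naive_orbit_collapse p (shellSetting p d) (rhoOne p d) (oneRho_thetaPinned p d) j vQ

end Naive

end CandInternal16

end Summit.ABC.IUTFork.Repair

end
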